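import Mathlib
import Literature.NumberTheory.LFunctions.BernoulliOneOdd
import Summits.HodgeConjecture.FermatCycles.HodgeFermatLemmaEGoodB
import Summits.HodgeConjecture.FermatCycles.HodgeFermatHypVDefs

/-!
# The Bad coefficients vanish by the uncertainty principle — part 1: Fourier analysis on `(ℤ/N)ˣ` with an exceptional set (`HodgeFermat/BadVanish.lean`; HF-G33)

Tree copy (part 1 of 4) of the module `HodgeFermat/BadVanish.lean` of the sibling cell's standalone package
`run/shared/lean/pub/pub-hodgefermat/lean/HodgeFermat/` (996 lines, sha256 `0bc1ccd5eb68b6bb…`), source lines 37–248 (§1 Fourier analysis on `(ℤ/N)ˣ` with an exceptional set: `hat`, `inversion`, `coreB`; §2 (anti)symmetrisation and parity of characters).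
Filed by cell `pub-hfermat`, seat prover-1 gen-2, on the COORDINATOR KEEPER RULING of 2026-08-25 (gem sweep H1: take the
off-gate kernel theorem `thmFstar` through the gate) — here its second namesake, `HodgeFermat/ThmFstarNFinal.lean:29`,
THEOREM F*(3N) at every admissible squarefree level (the first, `DecodingFinal.thmFstar` = THEOREM F* at the prime levels,
landed on 2026-08-25 as `HodgeFermatThmFstar.lean`, seat prover-1 gen-0); this file is one link of the import closure of
`ThmFstarNFinal.thmFstar` on top of that landed chain.  The source module's declarations are VERBATIM those of the cell record
`check/ThmFstarN_standalone.lean` (21 bodies, 438 871 B, sha256 ced731ec52c92191…, hub `lean check` rc 0, 222.2 s, `--axioms …ThmFstarN.thmFstarN` = [propext, Classical.choice, Quot.sound]; pub-hodgefermat `CERT.md` l.987, GATE HF-G33).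
Deviations from the source module, exhaustively: the `import` lines (tree modules `Summits.HodgeConjecture.FermatCycles.
HodgeFermat*` instead of `HodgeFermat.*`); this module docstring; DEDUP (pre-empting the gate's `dedup.landed`): the source's `lemma odd_inv'` (l.208–213) restates the landed `Literature.NumberTheory.LFunctions.BernoulliOneOdd.odd_inv` and the source's `lemma even_inv'` (l.215–220) restates the landed `HodgeFermat.KRFree.NuOdd.even_inv` (`HodgeFermatNuOdd.lean`); both are therefore DELETED and their names re-bound to the landed twins by the two added lines `open Literature.NumberTheory.LFunctions.BernoulliOneOdd renaming odd_inv → odd_inv'` / `open HodgeFermat.KRFree.NuOdd renaming even_inv → even_inv'` (here and in parts 3, 4), so that every use site (source l.661, 885, 909, 951, 980) stays byte-identical; one-line docstrings added (gate lint) to `hat_comp_neg`, `hat_sub_neg_of_even`, `hat_sub_neg_of_odd`, `hat_add_neg_of_odd`, `hat_add_neg_of_even`; the file ends at source l.248 (`end symm`) with an `end` line (parts 2–4 = `HodgeFermatBadVanishB/C/D.lean`).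
Every other line — in particular every declaration's statement and proof — is byte-identical to the source.
HONEST FRAMING: explicit algebraic cycles for specific Hodge classes on Fermat/Delsarte varieties; residual open instances
listed; no claim on general Hodge.  (This file is arithmetic of CM types / of `(ℤ/N)ˣ`; it claims nothing about cycles.)

The source module's docstring (BadVanish.lean l.7–35), verbatim:

## The BAD coefficients vanish: the uncertainty principle with an exceptional set, at any level (HF-G33)

`tables/DPRIME-THEOREM.md` §7.2 in the kernel, at an ARBITRARY squarefree level `N` (`3 ∤ N`), and from it
THEOREM F\*(3N) under the single numerical inequality `IneqV N` of `HypVDefs.lean` (HYPOTHESIS V, a theorem of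
`HypVRange.lean` + `HypVTail.lean` for every squarefree `N ≥ 25` prime to `210`).

The mechanism (§1, `coreB`): a function `f` on `ℤ/N` supported on at most `k` units whose character transform
`f̂(χ) = Σ_a f(a) χ(a)` vanishes outside a set `B` of characters with `k · #B < φ(N)` is identically zero (Fourier
inversion + the trivial bound `|f̂| ≤ Σ |f|`).  For two zero-sum triples `T`, `T′` mod `3N` with entries prime to `N`
and the same CM type:
* μ (§6): `E = μ_T − μ_T′` has at most 12-point support, so `E⁻(x) = E(x) − E(−x)` has at most 24; `Ê⁻` vanishes
  at the even characters and — LEMMA E, `LemmaEGood.hat_mu_diff_eq_zero_of_good` — at `χ` odd with `χ⁻¹` GOOD; the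
  remaining characters number at most `½ Σ_{q ∣ N} tauV N q` (§4–5: an odd character whose primitive character is `1`
  at a prime `q ∣ N` lies in Mathlib's `subgroupOfPrimitiveMapToOne … q`, of order `tauV N q = φ(N/q)/ord_{N/q}(q)`, and
  at most half of a subgroup is odd).  Hence `IneqV N ⟹ E⁻ = 0`: `E` is even, and ALL its odd coefficients vanish
  (`badVanishMu_of_ineq`).
* ν (§6): `D = ν_T − ν_T′` has at most 6-point support, `D⁺(x) = D(x) + D(−x)` at most 12; `D̂⁺` vanishes at the odd
  characters and at the even `χ ≠ 1` with `χ₃ × χ⁻¹` GOOD (`hat_nu_diff_eq_zero_of_good`); an even `ψ` mod `N` with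
  `χ₃ × ψ` BAD is (§5, `mem_cosetC_of_bad`: ramification at `3` excludes the prime `3`; badness at `q ∣ N` makes `ψ`
  factor through `N/q` with the value `χ₃(q)` at `q`) in one of the cosets `cosetC N q`, `#cosetC N q ≤ tauV N q`; so
  the exceptional set has at most `1 + Σ tauV` elements and `IneqV N ⟹ D⁺ = 0`: `D` is odd (`badVanishNu_of_ineq`).
* §7: `thmFstar_of_ineq` = `LemmaEGood.thmFstar_of_bad` with both Bad hypotheses discharged: THEOREM F\*(3N) for pairs
  with entries prime to `N` at every squarefree `N ≥ 11`, `3 ∤ N`, `N ≠ 13` satisfying `IneqV N`, from H0.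

LIGHT module (imports `LemmaEGood`, `HypVDefs`); no `sorry`; no `decide`; axioms [propext, Classical.choice,
Quot.sound] (hub record `check/BadVanish_standalone.lean`, 14 bodies).  The counting lemmas of §3 are those of
`HypBReduction.lean` §5 (re-proved here to keep the module light).  NOT imported by the root `HodgeFermat.lean`.
-/

set_option autoImplicit false

namespace HodgeFermat.KRFree.BadVanish

open Finset HodgeFermat.KRFree.LemmaN HodgeFermat.KRFree.TwistedMoment HodgeFermat.KRFree.LemmaEMu
open HodgeFermat.KRFree.LemmaEGood
open HodgeFermat.KRFree.ChiThree (chi3 chi3_mul_self)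
open HodgeFermat.KRFree.NuChar (chi3Mul chi3Mul_natCast)
open HodgeFermat.KRFree.MuEven (muEntry muFun)
open HodgeFermat.KRFree.NuOdd (nuEntry nuFun nuEntry_eq_zero)
open HodgeFermat.KRFree.HypVDefs (tauV IneqV)
open DirichletCharacter (changeLevel annihilator subgroupOfPrimitiveMapToOne)
open Literature.NumberTheory.LFunctions.BernoulliOneOdd renaming odd_inv → odd_inv'
open HodgeFermat.KRFree.NuOdd renaming even_inv → even_inv'

/-! ## 1. Fourier analysis on `(ℤ/N)ˣ` with an exceptional set -/

section core

variable {N : ℕ} [NeZero N] (f : ZMod N → ℂ)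

/-- `f̂(χ) = Σ_a f(a) χ(a)`. -/
noncomputable def hat (χ : DirichletCharacter ℂ N) : ℂ := ∑ a : ZMod N, f a * χ a

/-- Fourier inversion on the units: `Σ_χ χ(b⁻¹) f̂(χ) = φ(N) · f(b)`. -/
lemma inversion (b : (ZMod N)ˣ) :
    ∑ χ : DirichletCharacter ℂ N, χ ((b⁻¹ : (ZMod N)ˣ) : ZMod N) * hat f χ = (N.totient : ℂ) * f b := by
  have hb : IsUnit (b : ZMod N) := Units.isUnit b
  calc ∑ χ : DirichletCharacter ℂ N, χ ((b⁻¹ : (ZMod N)ˣ) : ZMod N) * hat f χ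
      = ∑ χ : DirichletCharacter ℂ N, ∑ a : ZMod N, f a * (χ ((b : ZMod N)⁻¹) * χ a) := by
          refine Finset.sum_congr rfl (fun χ _ => ?_)
          unfold hat
          rw [← ZMod.inv_coe_unit, Finset.mul_sum]
          exact Finset.sum_congr rfl (fun a _ => by ring)
    _ = ∑ a : ZMod N, f a * ∑ χ : DirichletCharacter ℂ N, χ ((b : ZMod N)⁻¹) * χ a := by
          rw [Finset.sum_comm]
          exact Finset.sum_congr rfl (fun a _ => by rw [Finset.mul_sum])
    _ = ∑ a : ZMod N, f a * (if (b : ZMod N) = a then (N.totient : ℂ) else 0) := by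
          refine Finset.sum_congr rfl (fun a _ => ?_)
          rw [DirichletCharacter.sum_char_inv_mul_char_eq ℂ hb a]
    _ = (N.totient : ℂ) * f b := by
          simp only [mul_ite, mul_zero]
          rw [Finset.sum_ite_eq]
          simp [mul_comm]

/-- `‖f̂(χ)‖ ≤ Σ_a ‖f a‖`. -/
lemma norm_hat_le (χ : DirichletCharacter ℂ N) : ‖hat f χ‖ ≤ ∑ a : ZMod N, ‖f a‖ := by
  unfold hat
  refine (norm_sum_le _ _).trans (Finset.sum_le_sum (fun a _ => ?_))
  rw [norm_mul]
  calc ‖f a‖ * ‖χ a‖ ≤ ‖f a‖ * 1 :=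
        mul_le_mul_of_nonneg_left (DirichletCharacter.norm_le_one χ a) (norm_nonneg _)
    _ = ‖f a‖ := mul_one _

/-- the pointwise bound `φ(N) ‖f b‖ ≤ #B · Σ_a ‖f a‖` when `f̂` vanishes off `B` and `f` off the units -/
lemma pointwise_bound (B : Finset (DirichletCharacter ℂ N)) (hunit : ∀ a, ¬ IsUnit a → f a = 0)
    (hB : ∀ χ, χ ∉ B → hat f χ = 0) (b : ZMod N) :
    (N.totient : ℝ) * ‖f b‖ ≤ (B.card : ℝ) * ∑ a : ZMod N, ‖f a‖ := by
  have hL : 0 ≤ ∑ a : ZMod N, ‖f a‖ := Finset.sum_nonneg (fun a _ => norm_nonneg _)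
  by_cases hb : IsUnit b
  · obtain ⟨b', rfl⟩ := hb
    have h1 : (N.totient : ℝ) * ‖f b'‖ =
        ‖∑ χ : DirichletCharacter ℂ N, χ ((b'⁻¹ : (ZMod N)ˣ) : ZMod N) * hat f χ‖ := by
      rw [inversion, norm_mul]
      simp
    have h2 : ∑ χ : DirichletCharacter ℂ N, χ ((b'⁻¹ : (ZMod N)ˣ) : ZMod N) * hat f χ
        = ∑ χ ∈ B, χ ((b'⁻¹ : (ZMod N)ˣ) : ZMod N) * hat f χ := by
      symm
      apply Finset.sum_subset (Finset.subset_univ _)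
      intro χ _ hχ
      rw [hB χ hχ, mul_zero]
    rw [h1, h2]
    refine (norm_sum_le _ _).trans ?_
    calc ∑ χ ∈ B, ‖χ ((b'⁻¹ : (ZMod N)ˣ) : ZMod N) * hat f χ‖
        ≤ ∑ χ ∈ B, (∑ a : ZMod N, ‖f a‖) := by
          refine Finset.sum_le_sum (fun χ _ => ?_)
          rw [norm_mul]
          calc ‖χ ((b'⁻¹ : (ZMod N)ˣ) : ZMod N)‖ * ‖hat f χ‖ ≤ 1 * ∑ a : ZMod N, ‖f a‖ :=
                mul_le_mul (DirichletCharacter.norm_le_one χ _) (norm_hat_le f χ) (norm_nonneg _)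
                  zero_le_one
            _ = ∑ a : ZMod N, ‖f a‖ := one_mul _
      _ = (B.card : ℝ) * ∑ a : ZMod N, ‖f a‖ := by
          rw [Finset.sum_const, nsmul_eq_mul]
  · rw [hunit b hb, norm_zero, mul_zero]
    exact mul_nonneg (Nat.cast_nonneg _) hL

/-- **The uncertainty principle with an exceptional set.**  A function on `ℤ/N` supported on at most `k` units
whose character transform vanishes outside a set `B` of characters with `k · #B < φ(N)` is zero. -/
theorem coreB (B : Finset (DirichletCharacter ℂ N)) (k : ℕ) (hunit : ∀ a, ¬ IsUnit a → f a = 0)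
    (hsupp : (Finset.univ.filter (fun a => f a ≠ 0)).card ≤ k)
    (hB : ∀ χ, χ ∉ B → hat f χ = 0) (hbad : k * B.card < N.totient) : ∀ a, f a = 0 := by
  set L : ℝ := ∑ a : ZMod N, ‖f a‖ with hLdef
  have hL : 0 ≤ L := Finset.sum_nonneg (fun a _ => norm_nonneg _)
  have hsum : L = ∑ a ∈ Finset.univ.filter (fun a => f a ≠ 0), ‖f a‖ := by
    rw [hLdef, Finset.sum_filter_of_ne]
    intro a _ ha
    exact norm_ne_zero_iff.mp ha
  have key : (N.totient : ℝ) * L ≤ k * (B.card : ℝ) * L := by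
    calc (N.totient : ℝ) * L
        = ∑ a ∈ Finset.univ.filter (fun a => f a ≠ 0), (N.totient : ℝ) * ‖f a‖ := by
          rw [hsum, Finset.mul_sum]
      _ ≤ ∑ a ∈ Finset.univ.filter (fun a => f a ≠ 0), (B.card : ℝ) * L :=
          Finset.sum_le_sum (fun a _ => pointwise_bound f B hunit hB a)
      _ = ((Finset.univ.filter (fun a => f a ≠ 0)).card : ℝ) * ((B.card : ℝ) * L) := by
          rw [Finset.sum_const, nsmul_eq_mul]
      _ ≤ (k : ℝ) * ((B.card : ℝ) * L) := by
          refine mul_le_mul_of_nonneg_right ?_ (mul_nonneg (Nat.cast_nonneg _) hL)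
          exact_mod_cast hsupp
      _ = k * (B.card : ℝ) * L := by ring
  have hbad' : (k : ℝ) * (B.card : ℝ) < (N.totient : ℝ) := by exact_mod_cast hbad
  have hL0 : L = 0 := by
    by_contra hne
    have hpos : 0 < L := lt_of_le_of_ne hL (Ne.symm hne)
    have := lt_of_lt_of_le (mul_lt_mul_of_pos_right hbad' hpos) key
    exact lt_irrefl _ this
  have hall : ∀ a ∈ (Finset.univ : Finset (ZMod N)), ‖f a‖ = 0 :=
    (Finset.sum_eq_zero_iff_of_nonneg (fun a _ => norm_nonneg _)).mp (by rw [← hLdef]; exact hL0)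
  intro a
  exact norm_eq_zero.mp (hall a (Finset.mem_univ a))

end core

/-! ## 2. (Anti)symmetrisation and parity of characters -/

section symm

variable {N : ℕ} [NeZero N] (f : ZMod N → ℂ)

/-- the coefficient of `x ↦ f(−x)` -/
lemma hat_comp_neg (χ : DirichletCharacter ℂ N) :
    hat (fun x => f (-x)) χ = ∑ a : ZMod N, f a * χ (-a) := by
  unfold hat
  exact Fintype.sum_equiv (Equiv.neg (ZMod N)) _ _ (fun a => by simp)

/-- the antisymmetrisation `f(x) − f(−x)` has no even coefficients -/
lemma hat_sub_neg_of_even (χ : DirichletCharacter ℂ N) (hχ : χ.Even) :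
    hat (fun x => f x - f (-x)) χ = 0 := by
  have h1 : hat (fun x => f x - f (-x)) χ = hat f χ - hat (fun x => f (-x)) χ := by
    unfold hat; simp only [sub_mul, Finset.sum_sub_distrib]
  rw [h1, hat_comp_neg, sub_eq_zero]
  unfold hat
  exact Finset.sum_congr rfl (fun a _ => by rw [DirichletCharacter.Even.eval_neg χ a hχ])

/-- the antisymmetrisation doubles the odd coefficients -/
lemma hat_sub_neg_of_odd (χ : DirichletCharacter ℂ N) (hχ : χ.Odd) :
    hat (fun x => f x - f (-x)) χ = 2 * hat f χ := by
  have h1 : hat (fun x => f x - f (-x)) χ = hat f χ - hat (fun x => f (-x)) χ := by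
    unfold hat; simp only [sub_mul, Finset.sum_sub_distrib]
  have h2 : hat (fun x => f (-x)) χ = - hat f χ := by
    rw [hat_comp_neg]
    unfold hat
    rw [← Finset.sum_neg_distrib]
    exact Finset.sum_congr rfl (fun a _ => by rw [DirichletCharacter.Odd.eval_neg χ a hχ]; ring)
  rw [h1, h2]; ring

/-- the symmetrisation `f(x) + f(−x)` has no odd coefficients -/
lemma hat_add_neg_of_odd (χ : DirichletCharacter ℂ N) (hχ : χ.Odd) :
    hat (fun x => f x + f (-x)) χ = 0 := by
  have h1 : hat (fun x => f x + f (-x)) χ = hat f χ + hat (fun x => f (-x)) χ := by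
    unfold hat; simp only [add_mul, Finset.sum_add_distrib]
  have h2 : hat (fun x => f (-x)) χ = - hat f χ := by
    rw [hat_comp_neg]
    unfold hat
    rw [← Finset.sum_neg_distrib]
    exact Finset.sum_congr rfl (fun a _ => by rw [DirichletCharacter.Odd.eval_neg χ a hχ]; ring)
  rw [h1, h2]; ring

/-- the symmetrisation doubles the even coefficients -/
lemma hat_add_neg_of_even (χ : DirichletCharacter ℂ N) (hχ : χ.Even) :
    hat (fun x => f x + f (-x)) χ = 2 * hat f χ := by
  have h1 : hat (fun x => f x + f (-x)) χ = hat f χ + hat (fun x => f (-x)) χ := by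
    unfold hat; simp only [add_mul, Finset.sum_add_distrib]
  have h2 : hat (fun x => f (-x)) χ = hat f χ := by
    rw [hat_comp_neg]
    unfold hat
    exact Finset.sum_congr rfl (fun a _ => by rw [DirichletCharacter.Even.eval_neg χ a hχ])
  rw [h1, h2]; ring

-- `odd_inv'`, `even_inv'` (source l.208–220): DELETED — verbatim restatements of the landed
-- `Literature.NumberTheory.LFunctions.BernoulliOneOdd.odd_inv` / `HodgeFermat.KRFree.NuOdd.even_inv`, re-bound by
-- the `open … renaming …` lines at the top of this file.

/-- an EVEN function has vanishing coefficients at the odd characters -/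
lemma sum_mul_eq_zero_of_even_odd (g : ZMod N → ℂ) (hg : ∀ x, g (-x) = g x) (χ : DirichletCharacter ℂ N)
    (hχ : χ.Odd) : ∑ x : ZMod N, g x * χ x = 0 := by
  have h : ∑ x : ZMod N, g x * χ x = - ∑ x : ZMod N, g x * χ x := by
    calc ∑ x : ZMod N, g x * χ x = ∑ x : ZMod N, g (-x) * χ (-x) :=
          Fintype.sum_equiv (Equiv.neg (ZMod N)) _ _ (fun a => by simp)
      _ = - ∑ x : ZMod N, g x * χ x := by
          rw [← Finset.sum_neg_distrib]
          exact Finset.sum_congr rfl (fun a _ => by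
            rw [hg, DirichletCharacter.Odd.eval_neg χ a hχ]; ring)
  have h2 : ∑ x : ZMod N, g x * χ x + ∑ x : ZMod N, g x * χ x = 0 := by linear_combination h
  exact add_self_eq_zero.mp h2

/-- an ODD function has vanishing coefficients at the even characters -/
lemma sum_mul_eq_zero_of_odd_even (g : ZMod N → ℂ) (hg : ∀ x, g (-x) = - g x) (χ : DirichletCharacter ℂ N)
    (hχ : χ.Even) : ∑ x : ZMod N, g x * χ x = 0 := by
  have h : ∑ x : ZMod N, g x * χ x = - ∑ x : ZMod N, g x * χ x := by
    calc ∑ x : ZMod N, g x * χ x = ∑ x : ZMod N, g (-x) * χ (-x) :=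
          Fintype.sum_equiv (Equiv.neg (ZMod N)) _ _ (fun a => by simp)
      _ = - ∑ x : ZMod N, g x * χ x := by
          rw [← Finset.sum_neg_distrib]
          exact Finset.sum_congr rfl (fun a _ => by
            rw [hg, DirichletCharacter.Even.eval_neg χ a hχ]; ring)
  have h2 : ∑ x : ZMod N, g x * χ x + ∑ x : ZMod N, g x * χ x = 0 := by linear_combination h
  exact add_self_eq_zero.mp h2

end symm

end HodgeFermat.KRFree.BadVanish
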